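import Mathlib.Geometry.Manifold.IntegralCurve.Basic
import Mathlib.Geometry.Manifold.Instances.Real
import Mathlib.Geometry.Manifold.SmoothEmbedding
import Literature.Geometry.Lorentzian.Causality
import Literature.Geometry.Lorentzian.Hypersurface
import Literature.Geometry.Lorentzian.AsymptoticFlatness
import HarnessLib

-- provenance: harness21/H21/H21/Prelude/Lorentz/Stationary.lean @ eed0bef (interim HEAD d8f2665); M5 mechanical rewrite
-- D-0014 re-migration (dependency drift): `[g.HasLeviCivita]` threaded through the Killing notions, the openness of
-- `I^±` (now named facts of `Causality.lean`) threaded as hypotheses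
-- 2026-08-15 (provefact seat StationaryAFBlackHole.IsAnalytic, not-a-fact): explicit binder `(𝓑)` on the PREDICATE
-- `StationaryAFBlackHole.IsAnalytic` (a definition — the analyticity hypothesis of gr.S23 — not a named fact; statement
-- unchanged) + unfolding/projection lemmas `isAnalytic_iff`, `IsAnalytic.isManifold_analytic`, `IsAnalytic.exists_analytic_metric`
-- 2026-08-15 (same seat, reviewer follow-up on p28994): docstring-only repair of the garbled cite tag on
-- `StationaryAFBlackHole` (`[cite: Heusler1996, Ch. 2]`; a sentence had leaked into the locator); no code change
/-!
# Hypotheses of stationary black-hole uniqueness (trunk G08 = T-LORENTZ, item C22)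

This file formalises the *hypotheses* of the black-hole uniqueness theorem (Carter–Robinson–
Hawking; Chruściel–Costa 2008, Thm. 1.3; **gr.S23** is stated in `H21/Statements/GR/BlackHoles`)
in the intrinsic, "stationary" form of Chruściel–Costa, *Astérisque* 321 (2008), §2, which avoids a
conformal completion at null infinity: given an asymptotically flat end `Σ_ext` of a spacelike
slice and a complete Killing field `X₀` timelike on `M_ext := ⋃ₜ φₜ(Σ_ext)`, the domain of outer
communications is `⟨⟨M_ext⟩⟩ := I⁺(M_ext) ∩ I⁻(M_ext)`, the black-hole region is `M ∖ I⁻(M_ext)`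
and the future event horizon is `𝓔⁺ := ∂I⁻(M_ext) ∩ I⁺(M_ext)` (CC08 (2.2)–(2.6)).

## Main definitions (namespace `Literature.Lorentz`)

For a `C^n` time-oriented Lorentzian manifold `(M, g, τ)` (context (TM) of the outline):

* `IsCompleteVectorField V`: every point lies on an integral curve of `V` defined on all of `ℝ`
  (Mathlib's `IsMIntegralCurve` is the whole-line notion);
* `stationaryOrbit V A = ⋃ₜ φₜ(A)`, the union of the (whole-line) integral curves of `V` through `A`;
* `LorentzianMetric.IsStationaryKilling g τ X₀ Mext`: `X₀` is a complete Killing field which is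
  future-directed timelike on `Mext`; `LorentzianMetric.IsAxisymmetricKilling g Y` (notion only:
  a complete Killing field generating a `U(1)` action with non-empty axis; *not* a hypothesis of
  gr.S23, where axisymmetry is an output of Hawking's rigidity theorem);
* `LorentzianMetric.docOfEnd g τ Mext = I⁺(Mext) ∩ I⁻(Mext)` (**gr.S16**, partial: DOC, event
  horizon, black-hole region in the stationary-intrinsic form), `futureEventHorizonOfEnd`,
  `blackHoleRegionOfEnd`, `IsNonDegenerateHorizon` (existence of a horizon Killing field `K`,
  tangent to and non-vanishing on `𝓔⁺`, with `∇_K K = κ K`, `κ ≠ 0` constant);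
* the `Spacetime` specialisations `Spacetime.IsStationaryKilling`, `Spacetime.stationaryOrbit`,
  `Spacetime.docOfEnd`, `Spacetime.futureEventHorizonOfEnd`, `Spacetime.blackHoleRegionOfEnd`,
  `Spacetime.IsNonDegenerateHorizon`, `Spacetime.IsAxisymmetricKilling`;
* the hypothesis structure `StationaryAFBlackHole`: a `4`-dimensional spacetime with an embedded
  spacelike slice `X` carrying an initial data set `D` with an end `e` on which the data are
  asymptotically flat of some order `α > 0` (`AFEnd.IsAsymptoticallyFlat`), and a stationary
  Killing field; derived `StationaryAFBlackHole.Mext`, `.doc`, `.docOpens`, `.horizon`,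
  and the separate analyticity hypothesis `StationaryAFBlackHole.IsAnalytic`.

## Mathlib

Mathlib (at the pin) has integral curves `IsMIntegralCurve γ v` (`γ : ℝ → M` a *global*
integral curve; `Mathlib/Geometry/Manifold/IntegralCurve/Basic.lean`), existence/uniqueness of
local integral curves, `Manifold.IsSmoothEmbedding`, `frontier`, but no completeness predicate for
vector fields (`rg -i 'complete vector field|IsCompleteVectorField'` is empty), no Killing
fields, no causal structure. We use the H21 modules `Causality` (`chronologicalFuture/Past`,
`isOpen_chronologicalFuture`), `LeviCivita` (`IsKillingField`, `leviCivita`), `Hypersurface`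
(`NormalField`, `IsFutureUnitNormal`, `secondFundamentalForm`), `Isometry` (`pullbackBilin`),
`InitialData` (`InitialDataSet`) and `AsymptoticFlatness` (`AFEnd`, `AFEnd.far`).

## Design choices

* All causal-theoretic notions are first defined for a general time-oriented `C^n` Lorentzian
  manifold (dot notation on `LorentzianMetric`, as in `Causality.lean`) and then specialised to
  bundled spacetimes `𝓢 : Spacetime d` by one-line `abbrev`s in `namespace Spacetime` (the names
  the statement files use).
* `futureEventHorizonOfEnd = frontier (I⁻(Mext)) ∩ I⁺(Mext)`. Since `I^±(Mext)` are open
  (`isOpen_chronologicalFuture`), this equals Chruściel–Costa's `𝓔⁺ = ∂⟨⟨M_ext⟩⟩ ∩ I⁺(M_ext)`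
  (CC08 (2.5)) and is contained in `H⁺ = ∂(M ∖ I⁻(M_ext))` (CC08 (2.3)); recorded as the
  lemma `futureEventHorizonOfEnd_eq_frontier_docOfEnd_inter`.
* `IsNonDegenerateHorizon` quantifies *existentially* over the horizon Killing field `K` (for
  rotating holes `K = X₀ + Ω Y` is an output of the rigidity theorem, not a datum), and asks for a
  single non-zero surface gravity `κ` on all of `𝓔⁺` (constancy of `κ` on each component is the
  zeroth law; CC08 §2.5, Heusler 1996 §6). Tangency of `K` to `𝓔⁺` is phrased through integral
  curves: those starting on `𝓔⁺` stay in `𝓔⁺`.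
* `StationaryAFBlackHole` carries the decay hypothesis `∃ α > 0, e.IsAsymptoticallyFlat D α`
  (CC08 §2.1) but **no** analyticity, **no** Cauchy-surface requirement and **no**
  `I⁺`-regularity of the DOC (CC08 Def. 1.1; a deliberate v0 omission recorded in the structure
  docstring); the slice enters only through its AF end (which defines `M_ext`) and the
  induced-data equations (sign convention (h): `K_ν(v, w) = + g(D_v ν, df w)` with the future
  unit normal). Analyticity is the separate predicate `StationaryAFBlackHole.IsAnalytic` (the given
  atlas is analytic and the metric is analytic in it), used as a hypothesis of gr.S23.
* No global `FiniteDimensional ℝ (TangentSpace I x)` instance is introduced.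
* **M5 migration (D-0014).** The Killing notions (`IsStationaryKilling`, `IsAxisymmetricKilling`,
  `IsNonDegenerateHorizon` and their `Spacetime` abbreviations) carry the standing Levi-Civita
  hypothesis `[g.HasLeviCivita]` of `LeviCivita.lean`; in the structure `StationaryAFBlackHole`
  the two fields built on the connection (`induced_k`, `isStationary`) are quantified over
  `[metric.HasLeviCivita]` (the pattern of `Development.lean`), so that the structure keeps its
  signature. Openness of `I^±(S)` is now the pair of named facts
  `LorentzianMetric.isOpen_chronologicalFuture/Past` (`Causality.lean`); the topological lemmas on
  the d.o.c., the black-hole region and the horizon, and `StationaryAFBlackHole.docOpens`, take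
  them as hypotheses `hF`, `hP`.

## References

* P. T. Chruściel, J. L. Costa, *On uniqueness of stationary vacuum black holes*, Astérisque 321
  (2008), 195–265, §1 (Thm. 1.3), §2.1–2.6 ((2.1) `M_ext`, (2.2) `⟨⟨M_ext⟩⟩`, (2.3)–(2.6)
  `B`, `H^±`, `𝓔^±`, §2.4 Killing horizons, §2.5 surface gravity / non-degeneracy).
* M. Heusler, *Black hole uniqueness theorems*, Cambridge Lecture Notes in Physics 6, CUP 1996,
  Ch. 2 (stationarity, axisymmetry), Ch. 6 (Killing horizons, surface gravity).
* S. W. Hawking, G. F. R. Ellis, *The large scale structure of space-time*, CUP 1973, §9.2–9.3.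
* R. M. Wald, *General Relativity*, Chicago 1984, §12.1, §12.3, §12.5.
* B. O'Neill, *Semi-Riemannian geometry*, Academic Press 1983, Ch. 9 (Killing fields,
  completeness of vector fields, Prop. 9.30).
-/

noncomputable section

open Bundle Set Manifold TopologicalSpace
open scoped ContDiff Topology

universe u

namespace Literature.Geometry.Lorentzian

variable {E : Type*} [NormedAddCommGroup E] [NormedSpace ℝ E] {H : Type*} [TopologicalSpace H]
  {I : ModelWithCorners ℝ E H} {M : Type*} [TopologicalSpace M] [ChartedSpace H M]
  [IsManifold I ∞ M] {n : ℕ∞ω}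

/-! ### Complete vector fields and their orbits -/

/-- A vector field `V` on `M` is **complete** if through every point `x` there is an integral
curve `γ : ℝ → M` of `V` defined on the whole real line with `γ 0 = x` (Mathlib's
`IsMIntegralCurve` is the whole-line notion), i.e. the flow of `V` is globally defined.
O'Neill 1983, Ch. 1, Def. 1.52 ff. and Ch. 9, p. 254; Lee, *Introduction to Smooth Manifolds*,
Ch. 9 (complete vector fields). [cite: ONeill1983, Ch. 1  Def. 1.52 ff. and Ch. 9  p. 254] -/
def IsCompleteVectorField (V : Π x : M, TangentSpace I x) : Prop :=
  ∀ x : M, ∃ γ : ℝ → M, IsMIntegralCurve γ V ∧ γ 0 = x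

/-- The **orbit of a set `A ⊆ M` under the flow of `V`**: the union `⋃ₜ φₜ(A)` of all whole-line
integral curves of `V` starting in `A`, i.e. the points `γ t` with `γ : ℝ → M` an integral curve of
`V`, `γ 0 ∈ A`. For the stationary Killing field and `A = Σ_ext` an asymptotically flat end of a
slice this is Chruściel–Costa's `M_ext := ⋃ₜ φₜ(Σ_ext)`, Astérisque 321 (2008), (2.1). [folklore] -/
def stationaryOrbit (V : Π x : M, TangentSpace I x) (A : Set M) : Set M :=
  {y | ∃ γ : ℝ → M, IsMIntegralCurve γ V ∧ γ 0 ∈ A ∧ ∃ t : ℝ, γ t = y}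

omit [IsManifold I ∞ M] in
/-- `A ⊆ ⋃ₜ φₜ(A)` when `V` is complete (take `t = 0`). Chruściel–Costa 2008, (2.1). [cite: Costa2008, (2.1] -/
lemma subset_stationaryOrbit {V : Π x : M, TangentSpace I x} (hV : IsCompleteVectorField V)
    (A : Set M) : A ⊆ stationaryOrbit V A := by
  intro x hx
  obtain ⟨γ, hγ, h0⟩ := hV x
  exact ⟨γ, hγ, h0 ▸ hx, 0, h0⟩

omit [IsManifold I ∞ M] in
/-- The orbit is monotone in the set. [folklore] -/
lemma stationaryOrbit_mono (V : Π x : M, TangentSpace I x) {A B : Set M} (h : A ⊆ B) :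
    stationaryOrbit V A ⊆ stationaryOrbit V B := by
  rintro y ⟨γ, hγ, h0, t, rfl⟩
  exact ⟨γ, hγ, h h0, t, rfl⟩

namespace LorentzianMetric

variable (g : LorentzianMetric I n M) (τ : TimeOrientation g)

/-! ### Stationary and axisymmetric Killing fields -/

section Killing

variable [FiniteDimensional ℝ E] [CompleteSpace E] [Fact (1 ≤ n)] [g.HasLeviCivita]

/-- `X₀` is a **stationary Killing field** of `(M, g, τ)` with respect to the region `Mext ⊆ M`
(meant: `M_ext = ⋃ₜ φₜ(Σ_ext)`): `X₀` is a Killing field of `g`, it is complete, and it is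
timelike and future-directed at every point of `Mext`. (Timelikeness is only required on the
asymptotic region: stationary black holes have ergoregions.) Chruściel–Costa, Astérisque 321
(2008), §1 (Thm. 1.3, "stationary") and §2.1; Heusler 1996, Def. 2.1. Standing hypothesis
`[g.HasLeviCivita]` (the Killing equation uses the Levi-Civita connection). [cite: Heusler1996, Def. 2.1] -/
def IsStationaryKilling (X₀ : Π x : M, TangentSpace I x) (Mext : Set M) : Prop :=
  g.IsKillingField X₀ ∧ IsCompleteVectorField X₀ ∧
    ∀ x ∈ Mext, g.IsTimelike (X₀ x) ∧ τ.IsFutureDirected (X₀ x)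

/-- `Y` is an **axisymmetric Killing field** of `(M, g)`: a complete Killing field all of whose
integral curves are `2π`-periodic (so its flow is an isometric `U(1)`-action), which is not
identically zero (the action is non-trivial — this excludes the vacuous example `Y = 0`) and whose
zero set (the *axis*) is non-empty (non-emptiness of the axis is Chruściel–Costa's convention;
some authors allow axis-free `U(1)`-actions). The periodicity clause quantifies over all
whole-line integral curves of `Y`. This is recorded as a notion only; it is **not** a hypothesis
of the uniqueness theorem gr.S23 (under analyticity, axisymmetry of a rotating hole follows from
Hawking's rigidity theorem). Chruściel–Costa, Astérisque 321 (2008), §1 (footnote to Thm. 1.3)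
and §2.1; Heusler 1996, Def. 2.6; Hawking–Ellis 1973, Prop. 9.3.6. Standing hypothesis
`[g.HasLeviCivita]`. [cite: Heusler1996, Def. 2.6] -/
def IsAxisymmetricKilling (Y : Π x : M, TangentSpace I x) : Prop :=
  g.IsKillingField Y ∧ IsCompleteVectorField Y ∧
    (∀ γ : ℝ → M, IsMIntegralCurve γ Y → Function.Periodic γ (2 * Real.pi)) ∧
    (∃ x : M, Y x ≠ 0) ∧ ∃ x : M, Y x = 0

variable {g τ} in
omit [FiniteDimensional ℝ E] [CompleteSpace E] [Fact (1 ≤ n)] in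
/-- A stationary Killing field is a Killing field. [folklore] -/
lemma IsStationaryKilling.isKillingField {X₀ : Π x : M, TangentSpace I x} {Mext : Set M}
    (h : g.IsStationaryKilling τ X₀ Mext) : g.IsKillingField X₀ :=
  h.1

variable {g τ} in
omit [FiniteDimensional ℝ E] [CompleteSpace E] [Fact (1 ≤ n)] in
/-- A stationary Killing field is complete. [folklore] -/
lemma IsStationaryKilling.isCompleteVectorField {X₀ : Π x : M, TangentSpace I x} {Mext : Set M}
    (h : g.IsStationaryKilling τ X₀ Mext) : IsCompleteVectorField X₀ :=
  h.2.1

variable {g τ} in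
omit [FiniteDimensional ℝ E] [CompleteSpace E] [Fact (1 ≤ n)] in
/-- A stationary Killing field is future-directed timelike on `Mext`. [folklore] -/
lemma IsStationaryKilling.isTimelike {X₀ : Π x : M, TangentSpace I x} {Mext : Set M}
    (h : g.IsStationaryKilling τ X₀ Mext) {x : M} (hx : x ∈ Mext) :
    g.IsTimelike (X₀ x) ∧ τ.IsFutureDirected (X₀ x) :=
  h.2.2 x hx

end Killing

/-! ### Domain of outer communications, event horizon, black-hole region of an end -/

/-- **gr.S16** (partial: domain of outer communications, event horizon, black-hole region — in
the stationary-intrinsic form; Chruściel–Costa, Astérisque 321 (2008), (2.2); Hawking–Ellis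
§9.2; Wald 1984 §12.1). The **domain of outer communications** of the region `Mext ⊆ M`
(meant: the orbit `M_ext = ⋃ₜ φₜ(Σ_ext)` of an asymptotically flat end under the stationary
Killing flow): `⟨⟨M_ext⟩⟩ := I⁺(M_ext) ∩ I⁻(M_ext)`, the events which can both receive signals from
and send signals to the asymptotic region. The Christodoulou intrinsic notion of complete null
infinity (the other half of gr.S16) is `HasCompleteFutureNullInfinity` in `NullInfinity.lean`;
the conformal-boundary version is `ConformalCompletion.domainOfOuterCommunications`. [cite: Wald1984, §12.1] -/
def docOfEnd (Mext : Set M) : Set M :=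
  g.chronologicalFuture τ Mext ∩ g.chronologicalPast τ Mext

/-- The **black-hole region** relative to `Mext`: `B := M ∖ I⁻(M_ext)`, the events from which no
signal reaches the asymptotic region. Chruściel–Costa, Astérisque 321 (2008), (2.3); Wald 1984,
§12.1 (with `𝓘⁺` replaced by `M_ext`). [cite: Wald1984, §12.1 (with  𝓘⁺  replaced by  M_ext] -/
def blackHoleRegionOfEnd (Mext : Set M) : Set M :=
  (g.chronologicalPast τ Mext)ᶜ

/-- The **future event horizon** relative to `Mext`: `𝓔⁺ := ∂I⁻(M_ext) ∩ I⁺(M_ext)`, the part of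
the boundary of the black-hole region `B = M ∖ I⁻(M_ext)` lying in the causal future of the
asymptotic region. Equals Chruściel–Costa's `𝓔⁺ = ∂⟨⟨M_ext⟩⟩ ∩ I⁺(M_ext)`
(`futureEventHorizonOfEnd_eq_frontier_docOfEnd_inter`). Chruściel–Costa, Astérisque 321 (2008),
(2.3)–(2.5); Hawking–Ellis 1973, §9.2; Wald 1984, §12.1. [cite: HawkingEllis1973, §9.2] -/
def futureEventHorizonOfEnd (Mext : Set M) : Set M :=
  frontier (g.chronologicalPast τ Mext) ∩ g.chronologicalFuture τ Mext

variable {g τ}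

/-- Unfolding lemma for `docOfEnd`. [folklore] -/
lemma mem_docOfEnd_iff {Mext : Set M} {x : M} :
    x ∈ g.docOfEnd τ Mext ↔ x ∈ g.chronologicalFuture τ Mext ∧ x ∈ g.chronologicalPast τ Mext :=
  Iff.rfl

/-- The future event horizon is part of the boundary of the black-hole region,
`𝓔⁺ ⊆ H⁺ = ∂B`. Chruściel–Costa, Astérisque 321 (2008), (2.3), (2.5). [folklore] -/
lemma futureEventHorizonOfEnd_subset_frontier_blackHoleRegionOfEnd (Mext : Set M) :
    g.futureEventHorizonOfEnd τ Mext ⊆ frontier (g.blackHoleRegionOfEnd τ Mext) := by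
  rw [blackHoleRegionOfEnd, frontier_compl]
  exact inter_subset_left

/-- The domain of outer communications is disjoint from the black-hole region.
Chruściel–Costa, Astérisque 321 (2008), §2.2. [folklore] -/
lemma disjoint_docOfEnd_blackHoleRegionOfEnd (Mext : Set M) :
    Disjoint (g.docOfEnd τ Mext) (g.blackHoleRegionOfEnd τ Mext) :=
  disjoint_compl_right.mono_left inter_subset_right

/-- The future event horizon is disjoint from the domain of outer communications (`I⁻(M_ext)` is
disjoint from its frontier as soon as it is open; here stated for `C²` metrics on boundaryless
manifolds, given the named fact `isOpen_chronologicalPast`, hypothesis `hP`). Chruściel–Costa,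
Astérisque 321 (2008), §2.2. [folklore] -/
theorem disjoint_futureEventHorizonOfEnd_docOfEnd [FiniteDimensional ℝ E] [T2Space M]
    [BoundarylessManifold I M] (hP : g.isOpen_chronologicalPast τ) (hn : 2 ≤ n) (Mext : Set M) :
    Disjoint (g.futureEventHorizonOfEnd τ Mext) (g.docOfEnd τ Mext) := by
  refine Set.disjoint_left.2 fun x hx hx' ↦ ?_
  have h := (hP hn Mext).inter_frontier_eq
  exact (Set.ext_iff.1 h x).1 ⟨hx'.2, hx.1⟩

section Topology

-- (2026-08-14: the `variable [FiniteDimensional ℝ E] [T2Space M] [BoundarylessManifold I M]` line that stood here was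
-- used by none of the three theorems of this section — `linter.unusedSectionVars` — and is dropped.)

/-- **The domain of outer communications is open** (`I^±` are open: the named facts
`isOpen_chronologicalFuture/Past`, hypotheses `hF`, `hP`). Chruściel–Costa,
Astérisque 321 (2008), §2.2; O'Neill 1983, Ch. 14, Lemma 14.3. [cite: ONeill1983, Ch. 14  Lemma 14.3] -/
theorem isOpen_docOfEnd (hF : g.isOpen_chronologicalFuture τ) (hP : g.isOpen_chronologicalPast τ)
    (hn : 2 ≤ n) (Mext : Set M) : IsOpen (g.docOfEnd τ Mext) :=
  (hF hn Mext).inter (hP hn Mext)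

/-- **The black-hole region is closed** (given the named fact `isOpen_chronologicalPast`,
hypothesis `hP`). Chruściel–Costa, Astérisque 321 (2008), §2.2. [folklore] -/
theorem isClosed_blackHoleRegionOfEnd (hP : g.isOpen_chronologicalPast τ) (hn : 2 ≤ n)
    (Mext : Set M) : IsClosed (g.blackHoleRegionOfEnd τ Mext) :=
  (hP hn Mext).isClosed_compl

/-- `𝓔⁺ = ∂⟨⟨M_ext⟩⟩ ∩ I⁺(M_ext)`: our future event horizon agrees with Chruściel–Costa's
definition (2.5) (both `I^±(M_ext)` are open: hypotheses `hF`, `hP`). Chruściel–Costa,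
Astérisque 321 (2008), (2.5). [folklore] -/
theorem futureEventHorizonOfEnd_eq_frontier_docOfEnd_inter (hF : g.isOpen_chronologicalFuture τ)
    (hP : g.isOpen_chronologicalPast τ) (hn : 2 ≤ n) (Mext : Set M) :
    g.futureEventHorizonOfEnd τ Mext =
      frontier (g.docOfEnd τ Mext) ∩ g.chronologicalFuture τ Mext := by
  have hU := hF hn Mext
  have hV := hP hn Mext
  simp only [futureEventHorizonOfEnd, docOfEnd, hV.frontier_eq, (hU.inter hV).frontier_eq]
  ext x
  constructor
  · rintro ⟨⟨hxV, hxV'⟩, hxU⟩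
    exact ⟨⟨hU.inter_closure ⟨hxU, hxV⟩, fun h ↦ hxV' h.2⟩, hxU⟩
  · rintro ⟨⟨hxcl, hxn⟩, hxU⟩
    exact ⟨⟨closure_mono inter_subset_right hxcl, fun h ↦ hxn ⟨hxU, h⟩⟩, hxU⟩

end Topology

/-! ### Non-degenerate horizons -/

section NonDegenerate

variable [FiniteDimensional ℝ E] [CompleteSpace E] [Fact (1 ≤ n)] [g.HasLeviCivita]

variable (g τ) in
/-- The future event horizon `𝓔⁺` of `Mext` is a **non-degenerate Killing horizon**: there is a
Killing field `K` of `g` (for a static hole `K = X₀`; for a rotating hole `K = X₀ + Ω Y`, an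
*output* of Hawking's rigidity theorem — hence the existential quantifier) which is nowhere zero
on `𝓔⁺`, is tangent to `𝓔⁺` (every integral curve of `K` starting on `𝓔⁺` stays in `𝓔⁺`), and
satisfies `∇_K K = κ K` on `𝓔⁺` for a single **non-zero** constant `κ` (the surface gravity; its
constancy on each component of the horizon is the zeroth law).

*Warning:* if `𝓔⁺ = ∅` the predicate holds trivially (`K = 0`, `κ = 1`); it is **not** a
"there is a black hole" hypothesis and must be combined with non-emptiness/connectedness of the
horizon (as gr.S23 does). Chruściel–Costa, Astérisque 321 (2008), §2.4–2.5 (Killing horizons,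
`∇_K K = κ K`, (mean-)non-degeneracy `κ ≠ 0`); Heusler 1996, §6.1–6.3; Wald 1984, §12.5,
(12.5.2). Standing hypothesis `[g.HasLeviCivita]`. [cite: Heusler1996, §6.1–6.3] -/
def IsNonDegenerateHorizon (Mext : Set M) : Prop :=
  ∃ K : Π x : M, TangentSpace I x, g.IsKillingField K ∧
    (∀ p ∈ g.futureEventHorizonOfEnd τ Mext, K p ≠ 0) ∧
    (∀ γ : ℝ → M, IsMIntegralCurve γ K → γ 0 ∈ g.futureEventHorizonOfEnd τ Mext →
      ∀ t, γ t ∈ g.futureEventHorizonOfEnd τ Mext) ∧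
    ∃ κ : ℝ, κ ≠ 0 ∧ ∀ p ∈ g.futureEventHorizonOfEnd τ Mext, g.leviCivita K p (K p) = κ • K p

end NonDegenerate

end LorentzianMetric

/-! ### Specialisation to bundled spacetimes -/

namespace Spacetime

variable {d : ℕ} (𝓢 : Spacetime.{u} d)

/-- `X₀` is a **stationary Killing field** of the spacetime `𝓢` with respect to `Mext`
(`LorentzianMetric.IsStationaryKilling` for `𝓢.metric`, `𝓢.timeOrientation`). Chruściel–Costa,
Astérisque 321 (2008), §1, §2.1; Heusler 1996, Def. 2.1. Standing hypothesis
`[𝓢.metric.HasLeviCivita]`. [cite: Heusler1996, Def. 2.1] -/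
abbrev IsStationaryKilling [𝓢.metric.HasLeviCivita] (X₀ : Π x : 𝓢.carrier, TangentSpace (𝓡 d) x)
    (Mext : Set 𝓢.carrier) : Prop :=
  𝓢.metric.IsStationaryKilling 𝓢.timeOrientation X₀ Mext

/-- `Y` is an **axisymmetric Killing field** of the spacetime `𝓢` (notion only; not a hypothesis of
gr.S23); `[𝓢.metric.HasLeviCivita]` as above. Chruściel–Costa, Astérisque 321 (2008), §1, §2.1;
Heusler 1996, Def. 2.6. [cite: Heusler1996, Def. 2.6] -/
abbrev IsAxisymmetricKilling [𝓢.metric.HasLeviCivita] (Y : Π x : 𝓢.carrier, TangentSpace (𝓡 d) x) :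
    Prop :=
  𝓢.metric.IsAxisymmetricKilling Y

/-- The orbit `⋃ₜ φₜ(A)` of `A` under the flow of the vector field `X₀` on the spacetime `𝓢`
(`stationaryOrbit`). Chruściel–Costa, Astérisque 321 (2008), (2.1). [folklore] -/
abbrev stationaryOrbit (X₀ : Π x : 𝓢.carrier, TangentSpace (𝓡 d) x) (A : Set 𝓢.carrier) :
    Set 𝓢.carrier :=
  Literature.Geometry.Lorentzian.stationaryOrbit X₀ A

/-- **gr.S16** (partial: domain of outer communications `⟨⟨M_ext⟩⟩ = I⁺(M_ext) ∩ I⁻(M_ext)` of a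
spacetime relative to the asymptotic region `M_ext`, stationary-intrinsic form; Chruściel–Costa,
Astérisque 321 (2008), (2.2); Hawking–Ellis §9.2; Wald 1984 §12.1). Specialisation of
`LorentzianMetric.docOfEnd` to the bundled spacetime `𝓢`. [cite: Wald1984, §12.1] -/
abbrev docOfEnd (Mext : Set 𝓢.carrier) : Set 𝓢.carrier :=
  𝓢.metric.docOfEnd 𝓢.timeOrientation Mext

/-- The future event horizon `𝓔⁺ = ∂I⁻(M_ext) ∩ I⁺(M_ext)` of the spacetime `𝓢` relative to
`Mext` (`LorentzianMetric.futureEventHorizonOfEnd`). Chruściel–Costa, Astérisque 321 (2008),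
(2.3)–(2.5). [folklore] -/
abbrev futureEventHorizonOfEnd (Mext : Set 𝓢.carrier) : Set 𝓢.carrier :=
  𝓢.metric.futureEventHorizonOfEnd 𝓢.timeOrientation Mext

/-- The black-hole region `B = M ∖ I⁻(M_ext)` of the spacetime `𝓢` relative to `Mext`
(`LorentzianMetric.blackHoleRegionOfEnd`). Chruściel–Costa, Astérisque 321 (2008), (2.3). [folklore] -/
abbrev blackHoleRegionOfEnd (Mext : Set 𝓢.carrier) : Set 𝓢.carrier :=
  𝓢.metric.blackHoleRegionOfEnd 𝓢.timeOrientation Mext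

/-- The future event horizon of `𝓢` relative to `Mext` is a non-degenerate Killing horizon
(`LorentzianMetric.IsNonDegenerateHorizon`; the horizon Killing field is quantified
existentially); `[𝓢.metric.HasLeviCivita]` as above. Chruściel–Costa, Astérisque 321 (2008),
§2.4–2.5; Heusler 1996, §6. [cite: Heusler1996, §6] -/
abbrev IsNonDegenerateHorizon [𝓢.metric.HasLeviCivita] (Mext : Set 𝓢.carrier) : Prop :=
  𝓢.metric.IsNonDegenerateHorizon 𝓢.timeOrientation Mext

/-- `2 ≤ ∞` in `ℕ∞ω` (regularity side condition of the causality lemmas; private helper). [folklore] -/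
private lemma two_le_infty : (2 : ℕ∞ω) ≤ ∞ :=
  WithTop.coe_le_coe.mpr le_top

/-- The domain of outer communications of a spacetime is open (given the named facts
`isOpen_chronologicalFuture/Past` for `𝓢`, hypotheses `hF`, `hP`). Chruściel–Costa, Astérisque 321
(2008), §2.2; O'Neill 1983, Ch. 14, Lemma 14.3. [cite: ONeill1983, Ch. 14  Lemma 14.3] -/
theorem isOpen_docOfEnd (hF : 𝓢.metric.isOpen_chronologicalFuture 𝓢.timeOrientation)
    (hP : 𝓢.metric.isOpen_chronologicalPast 𝓢.timeOrientation) (Mext : Set 𝓢.carrier) :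
    IsOpen (𝓢.docOfEnd Mext) :=
  𝓢.metric.isOpen_docOfEnd (τ := 𝓢.timeOrientation) hF hP two_le_infty Mext

/-- The future event horizon of a spacetime is disjoint from its domain of outer communications
(given the named fact `isOpen_chronologicalPast` for `𝓢`, hypothesis `hP`).
Chruściel–Costa, Astérisque 321 (2008), §2.2. [folklore] -/
theorem disjoint_futureEventHorizonOfEnd_docOfEnd
    (hP : 𝓢.metric.isOpen_chronologicalPast 𝓢.timeOrientation) (Mext : Set 𝓢.carrier) :
    Disjoint (𝓢.futureEventHorizonOfEnd Mext) (𝓢.docOfEnd Mext) :=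
  𝓢.metric.disjoint_futureEventHorizonOfEnd_docOfEnd (τ := 𝓢.timeOrientation) hP two_le_infty Mext

end Spacetime

/-! ### The hypothesis structure of stationary asymptotically flat black holes -/

/-- A **stationary asymptotically flat black-hole spacetime** (the hypotheses of the uniqueness
theorem gr.S23, minus analyticity, vacuum, connectedness and non-degeneracy of the horizon, which
are stated separately): a `4`-dimensional spacetime `(M, g, τ)` together with

* a connected `3`-manifold `X` (the slice `Σ`), an initial data set `D = (h, k)` on `X` and an
  end `e` of `X` (`Σ_ext = e.U`) on which the data are asymptotically flat,
  `h - δ = O₂(r^{-α})`, `k = O₁(r^{-α-1})` for some `α > 0` (CC08 §2.1; `AFEnd.IsAsymptoticallyFlat`);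
* a smooth embedding `embed : X → M` with future unit normal `normal`, inducing the data:
  `embed^* g = h` and `K_normal = k` (sign convention `K_ν(v, w) = + g(D_v ν, df w)`, Wald
  (10.2.13)); **no** Cauchy-surface requirement is made;
* a Killing field `killing = X₀` which is complete and future-directed timelike on
  `M_ext := ⋃ₜ φₜ(embed(Σ_ext'))`, where `Σ_ext' = e.far (e.R + 1)` is a far region of the end.

The two fields built on the Levi-Civita connection (`induced_k`, `isStationary`) are quantified
over the standing hypothesis `[metric.HasLeviCivita]` (pattern of `Development.lean`).

**Not encoded (deliberate v0 omissions, to be kept in mind by whoever states gr.S23):**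
Chruściel–Costa's global regularity hypothesis "`I⁺`-regularity" of the domain of outer
communications (CC08, Def. 1.1 / hypotheses of Thm. 1.3: `⟨⟨M_ext⟩⟩` globally hyperbolic with a
suitable Cauchy surface reaching the horizon) and any Cauchy-surface property of the slice.

Chruściel–Costa, Astérisque 321 (2008), §1 (hypotheses of Thm. 1.3) and §2.1 ((2.1), asymptotic
flatness and stationarity via an end of a spacelike hypersurface); Bartnik, CPAM 39 (1986),
Def. 2.1 (decay); Heusler 1996, Ch. 2. This is a *hypothesis structure* (data + the properties the
statements consume). [cite: Heusler1996, Ch. 2] -/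
structure StationaryAFBlackHole extends Spacetime.{u} 4 where
  /-- The slice `Σ` (a `3`-manifold). -/
  X : Type u
  /-- The topology of the slice. -/
  [topologicalSpaceX : TopologicalSpace X]
  /-- The `C^∞` atlas of the slice, modelled on `ℝ³`. -/
  [chartedSpaceX : ChartedSpace E3 X]
  /-- The charts of the slice are `C^∞`-compatible. -/
  [isManifoldX : IsManifold (𝓡 3) ∞ X]
  /-- The slice is Hausdorff. -/
  [t2SpaceX : T2Space X]
  /-- The slice is second countable. -/
  [secondCountableTopologyX : SecondCountableTopology X]
  /-- The slice is connected. -/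
  [connectedSpaceX : ConnectedSpace X]
  /-- The initial data set `(h, k)` on the slice. -/
  D : InitialDataSet (𝓡 3) X
  /-- The asymptotically flat end `Σ_ext` of the slice. -/
  e : AFEnd X
  /-- The data are asymptotically flat on the end: `h - δ = O₂(r^{-α})`, `k = O₁(r^{-α-1})` for
  some `α > 0` (Chruściel–Costa 2008, §2.1; Bartnik 1986, Def. 2.1). -/
  isAsymptoticallyFlat : ∃ α : ℝ, 0 < α ∧ e.IsAsymptoticallyFlat D α
  /-- The embedding of the slice into spacetime. -/
  embed : X → carrier
  /-- The future unit normal of the embedded slice. -/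
  normal : NormalField (𝓡 4) embed
  /-- `embed` is a smooth embedding. -/
  isSmoothEmbedding : Manifold.IsSmoothEmbedding (𝓡 3) (𝓡 4) ∞ embed
  /-- `normal` is the future-directed unit normal of the slice. -/
  isFutureUnitNormal : metric.IsFutureUnitNormal (𝓡 3) timeOrientation embed normal
  /-- The metric induces `h`: `embed^* g = h`. -/
  induced_h : ∀ y : X, pullbackBilin (I := 𝓡 4) (I' := 𝓡 3) embed metric.val y = D.h.inner y
  /-- The second fundamental form w.r.t. the future normal is `k` (as in `Development`; under the
  standing Levi-Civita hypothesis `[metric.HasLeviCivita]` of `Hypersurface.lean`). -/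
  induced_k : ∀ [metric.HasLeviCivita], ∀ y : X,
    metric.toPseudoRiemannianMetric.secondFundamentalForm (𝓡 3) embed normal y = D.kBilin y
  /-- The stationary Killing field `X₀`. -/
  killing : Π x : carrier, TangentSpace (𝓡 4) x
  /-- `X₀` is a complete Killing field, future-directed timelike on
  `M_ext = ⋃ₜ φₜ(embed(e.far (e.R + 1)))` (definitional expansion of
  `toSpacetime.IsStationaryKilling killing Mext`, see `StationaryAFBlackHole.isStationaryKilling`;
  under the standing Levi-Civita hypothesis `[metric.HasLeviCivita]`). -/
  isStationary : ∀ [metric.HasLeviCivita], metric.IsStationaryKilling timeOrientation killing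
    (stationaryOrbit killing (embed '' e.far (e.R + 1)))

attribute [instance] StationaryAFBlackHole.topologicalSpaceX StationaryAFBlackHole.chartedSpaceX
  StationaryAFBlackHole.isManifoldX StationaryAFBlackHole.t2SpaceX
  StationaryAFBlackHole.secondCountableTopologyX StationaryAFBlackHole.connectedSpaceX

namespace StationaryAFBlackHole

variable (𝓑 : StationaryAFBlackHole.{u})

/-- The asymptotic region `M_ext := ⋃ₜ φₜ(Σ_ext')` of the stationary black hole: the orbit under
the stationary Killing flow of the embedded far region `Σ_ext' = e.far (e.R + 1)` of the AF end.
Chruściel–Costa, Astérisque 321 (2008), (2.1). [folklore] -/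
def Mext : Set 𝓑.carrier :=
  𝓑.toSpacetime.stationaryOrbit 𝓑.killing (𝓑.embed '' 𝓑.e.far (𝓑.e.R + 1))

/-- The stationary Killing field of `𝓑` is a stationary Killing field w.r.t. `𝓑.Mext`
(repackaging of the field `isStationary`, under `[𝓑.metric.HasLeviCivita]`). Chruściel–Costa,
Astérisque 321 (2008), §2.1. [folklore] -/
lemma isStationaryKilling [𝓑.metric.HasLeviCivita] :
    𝓑.toSpacetime.IsStationaryKilling 𝓑.killing 𝓑.Mext :=
  𝓑.isStationary

/-- The embedded far region of the end lies in `M_ext` (completeness of `X₀`, a clause of the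
field `isStationary`, whence the hypothesis `[𝓑.metric.HasLeviCivita]`). Chruściel–Costa 2008,
(2.1). [cite: Costa2008, (2.1] -/
lemma image_far_subset_Mext [𝓑.metric.HasLeviCivita] :
    𝓑.embed '' 𝓑.e.far (𝓑.e.R + 1) ⊆ 𝓑.Mext :=
  subset_stationaryOrbit 𝓑.isStationary.isCompleteVectorField _

/-- The **domain of outer communications** `⟨⟨M_ext⟩⟩ = I⁺(M_ext) ∩ I⁻(M_ext)` of the stationary
black hole. Chruściel–Costa, Astérisque 321 (2008), (2.2). [folklore] -/
def doc : Set 𝓑.carrier :=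
  𝓑.toSpacetime.docOfEnd 𝓑.Mext

/-- The domain of outer communications is open (given the named facts
`isOpen_chronologicalFuture/Past` for `𝓑`, hypotheses `hF`, `hP`). Chruściel–Costa, Astérisque 321
(2008), §2.2. [folklore] -/
theorem isOpen_doc (hF : 𝓑.metric.isOpen_chronologicalFuture 𝓑.timeOrientation)
    (hP : 𝓑.metric.isOpen_chronologicalPast 𝓑.timeOrientation) : IsOpen 𝓑.doc :=
  𝓑.toSpacetime.isOpen_docOfEnd hF hP 𝓑.Mext

/-- The domain of outer communications as an open subset of spacetime (hence an open
submanifold, the domain of the isometry to a Kerr exterior in gr.S23); its openness rests on the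
named facts `isOpen_chronologicalFuture/Past` (hypotheses `hF`, `hP`). Chruściel–Costa,
Astérisque 321 (2008), (2.2) and Thm. 1.3. [folklore] -/
def docOpens (hF : 𝓑.metric.isOpen_chronologicalFuture 𝓑.timeOrientation)
    (hP : 𝓑.metric.isOpen_chronologicalPast 𝓑.timeOrientation) : Opens 𝓑.carrier :=
  ⟨𝓑.doc, 𝓑.isOpen_doc hF hP⟩

/-- The underlying set of `docOpens` is `doc`. [folklore] -/
@[simp]
lemma coe_docOpens (hF : 𝓑.metric.isOpen_chronologicalFuture 𝓑.timeOrientation)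
    (hP : 𝓑.metric.isOpen_chronologicalPast 𝓑.timeOrientation) :
    (𝓑.docOpens hF hP : Set 𝓑.carrier) = 𝓑.doc := rfl

/-- The **future event horizon** `𝓔⁺ = ∂I⁻(M_ext) ∩ I⁺(M_ext)` of the stationary black hole.
Chruściel–Costa, Astérisque 321 (2008), (2.5). [folklore] -/
def horizon : Set 𝓑.carrier :=
  𝓑.toSpacetime.futureEventHorizonOfEnd 𝓑.Mext

/-- The **black-hole region** `B = M ∖ I⁻(M_ext)` of the stationary black hole. Chruściel–Costa,
Astérisque 321 (2008), (2.3). [folklore] -/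
def blackHoleRegion : Set 𝓑.carrier :=
  𝓑.toSpacetime.blackHoleRegionOfEnd 𝓑.Mext

/-- The horizon is disjoint from the domain of outer communications (given the named fact
`isOpen_chronologicalPast` for `𝓑`, hypothesis `hP`). Chruściel–Costa, Astérisque 321 (2008),
§2.2. [folklore] -/
theorem disjoint_horizon_doc (hP : 𝓑.metric.isOpen_chronologicalPast 𝓑.timeOrientation) :
    Disjoint 𝓑.horizon 𝓑.doc :=
  𝓑.toSpacetime.disjoint_futureEventHorizonOfEnd_docOfEnd hP 𝓑.Mext

/-- The data of `𝓑` are asymptotically flat of some positive order on the end (repackaging of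
the field `isAsymptoticallyFlat`). Chruściel–Costa 2008, §2.1. [cite: Costa2008, §2.1] -/
lemma exists_isAsymptoticallyFlat : ∃ α : ℝ, 0 < α ∧ 𝓑.e.IsAsymptoticallyFlat 𝓑.D α :=
  𝓑.isAsymptoticallyFlat

/-- The stationary black hole `𝓑` is **analytic** — the *analyticity hypothesis* of gr.S23. This
is a DEFINITION — a predicate `StationaryAFBlackHole → Prop` on the datum `𝓑` (in the manner of
`Spacetime.IsNonDegenerateHorizon`), written with the explicit binder `(𝓑)` so that it is not read
as a closed named fact: it holds for some stationary asymptotically flat black holes (Kerr in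
ingoing Kerr–Schild coordinates) and fails for others (any `𝓑` whose metric has a smooth
non-analytic component in one of its charts, e.g. `ℝ⁴` with `-dt² + h` for a smooth, non-analytic,
asymptotically Euclidean Riemannian `h` on `ℝ³` and Killing field `∂ₜ`), so there is nothing to
discharge (no `IsAnalytic_holds`); it enters gr.S23 as the hypothesis `𝓑.IsAnalytic →` of
`stationary_black_hole_uniqueness` (`BlackHoles.lean`).

What is formalised: the *given* atlas of the carrier `𝓑.carrier` is real-analytic
(`IsManifold (𝓡 4) ω`, i.e. all transition maps of the `ChartedSpace` structure of `𝓑` are `C^ω`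
— slightly stronger than "admits a compatible analytic sub-atlas") and the metric is analytic in
it, i.e. it is (the `C^∞` metric underlying) a real-analytic Lorentzian metric. This is the
analyticity hypothesis of the Hawking rigidity step of gr.S23: Hawking–Ellis 1973, §9.3, call a
space-time satisfying their conditions (1)–(3) a *stationary regular predictable space*, note in
the paragraph following them that (2)–(3) make `(M, g)` analytic near infinity where the Killing
field is timelike (Müller zum Hagen 1970) and "take the solution elsewhere to be the analytic
continuation of this outer region", and use "the analyticity of the metric `g`" in the proof of the
rigidity theorem Prop. 9.3.6 (a stationary non-static regular predictable space whose ergosphere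
meets the horizon admits a one-parameter cyclic isometry group commuting with `θ_t`);
Chruściel–Costa, Astérisque 321 (2008), Thm. 1.3 ("analytic"); Heusler 1996, §6.
[cite: HawkingEllis1973, §9.3 conditions (1)–(3) ff. and Prop. 9.3.6] -/
def IsAnalytic (𝓑 : StationaryAFBlackHole.{u}) : Prop :=
  IsManifold (𝓡 4) ω 𝓑.carrier ∧
    ∃ g : LorentzianMetric (𝓡 4) ω 𝓑.carrier,
      g.toPseudoRiemannianMetric.ofLE le_top = 𝓑.metric.toPseudoRiemannianMetric

variable {𝓑} in
/-- An analytic stationary black hole has a real-analytic (given) atlas: first clause of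
`IsAnalytic`. [folklore] -/
lemma IsAnalytic.isManifold_analytic (h : 𝓑.IsAnalytic) : IsManifold (𝓡 4) ω 𝓑.carrier :=
  h.1

variable {𝓑} in
/-- The metric of an analytic stationary black hole underlies a real-analytic Lorentzian metric in
the given atlas: second clause of `IsAnalytic`. [folklore] -/
lemma IsAnalytic.exists_analytic_metric (h : 𝓑.IsAnalytic) :
    ∃ g : LorentzianMetric (𝓡 4) ω 𝓑.carrier,
      g.toPseudoRiemannianMetric.ofLE le_top = 𝓑.metric.toPseudoRiemannianMetric :=
  h.2

/-- Unfolding lemma for `IsAnalytic`. [folklore] -/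
lemma isAnalytic_iff : 𝓑.IsAnalytic ↔
    IsManifold (𝓡 4) ω 𝓑.carrier ∧
      ∃ g : LorentzianMetric (𝓡 4) ω 𝓑.carrier,
        g.toPseudoRiemannianMetric.ofLE le_top = 𝓑.metric.toPseudoRiemannianMetric :=
  Iff.rfl

end StationaryAFBlackHole

end Literature.Geometry.Lorentzian

end
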